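import Summits.AtomisticToContinuum.FouriersLaw.Theorems.VanishingNoiseTransferNoisyFourierFlipResolventForward
import Summits.AtomisticToContinuum.FouriersLaw.Theorems.VanishingNoiseTransferVanishingNoiseBoundJumpPerturbationCore
import Summits.AtomisticToContinuum.FouriersLaw.Theorems.EmbeddedDrudeMourreNessUnique
import Literature.MathematicalPhysics.KineticTheory.VelocityFlipEmbeddedChain

/-!
# Resolvent identification of weak flip steady states, part 8: the registered stub
`stub_flipSteadyState_eq_bind_resolventKernel`

`--supports stmt-AtomisticToContinuum-11977` file (crux `NoisyFourier`, route `VanishingNoiseTransfer`, line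
`sector-dirichlet-gluing`). For the pinned anharmonic chain `pinnedChain ω₂ lam β γ` (all parameters `> 0`), `N ≥ 1`,
`T_L, T_R > 0`, flip rate `ε > 0`: a weak steady state `μ` of the velocity-flip dynamics `L + εS` with a smooth
density `ρ` EQUALS `(μQ) R_{Nε}`, `Q = flipKernel N` the uniform single-site flip and `R_r` the resolvent kernel of the
constructed transition semigroup `pinnedChainSemigroup` (flip-free dynamics observed at an independent `Exp_r` time).

Proof. `ρ` solves `L̂ρ + (2γ - r)ρ + g = 0` pointwise, `r = Nε`, `g = ε ∑ᵢ ρ∘Θᵢ ≥ 0` (part 1); parts 2–7 give, for every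
measurable `A`, `∫_{s>0} e^{-rs} ∫ g(x) P_s(x,A) dx ds ≤ μ(A)` for the transition kernels `P_s`; the left side is
`((μQ) R_r)(A)` (`resolventKernel_apply`, the exponential law, the flips preserve Liouville measure,
`P_s = langevinKernel = transitionKernel`), and two probability measures comparable setwise are equal. No definitions.
-/

noncomputable section

open MeasureTheory ProbabilityTheory Filter Topology Set
open scoped NNReal ENNReal ContDiff

namespace Summit.AtomisticToContinuum.FouriersLaw.Theorems.NoisyFourier.FlipResolvent

open Literature.MathematicalPhysics.KineticTheory.HeatConduction
open Literature.MathematicalPhysics.KineticTheory Literature.Probability.Process OscillatorChain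
open Summit.AtomisticToContinuum.FouriersLaw.Theorems.SubdiffusiveBondHeat
open Summit.AtomisticToContinuum.FouriersLaw.Theorems.NessUnique
open Summit.AtomisticToContinuum.FouriersLaw.Theorems.VanishingNoiseBound.JumpPerturbation (lintegral_expMeasure)

variable {N : ℕ}

/-- Change of variables under a velocity flip, Lebesgue form: `∫ F(Θᵢ x) dx = ∫ F dx` for measurable `F ≥ 0`.
[folklore] -/
theorem lintegral_comp_momentumFlip_volume (i : Fin N) {F : PhaseSpace N → ℝ≥0∞} (hF : Measurable F) :
    ∫⁻ x, F (momentumFlip i x) = ∫⁻ x, F x :=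
  (measurePreserving_momentumFlip_volume i).lintegral_comp hF

/-- **The source side**: for `g = ε ∑ᵢ ρ∘Θᵢ` and a measurable family of measures `κ`,
`∫ g(x) κ(x)(A) dx = ε ∑ᵢ ∫ ρ(x) κ(Θᵢ x)(A) dx` (the flips are involutions preserving Liouville measure). [folklore] -/
theorem lintegral_flipSource_mul_eq (ε : ℝ) (hε : 0 ≤ ε) {ρ : PhaseSpace N → ℝ} (hρm : Measurable ρ) (hρ0 : ∀ x, 0 ≤ ρ x)
    {κ : PhaseSpace N → ℝ≥0∞} (hκ : Measurable κ) :
    ∫⁻ x, ENNReal.ofReal (ε * ∑ i : Fin N, ρ (momentumFlip i x)) * κ x =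
      ENNReal.ofReal ε * ∑ i : Fin N, ∫⁻ x, ENNReal.ofReal (ρ x) * κ (momentumFlip i x) := by
  have hρm' : Measurable fun x => ENNReal.ofReal (ρ x) := hρm.ennreal_ofReal
  have e1 : ∀ x, ENNReal.ofReal (ε * ∑ i : Fin N, ρ (momentumFlip i x)) =
      ENNReal.ofReal ε * ∑ i : Fin N, ENNReal.ofReal (ρ (momentumFlip i x)) := fun x => by
    rw [ENNReal.ofReal_mul hε, ENNReal.ofReal_sum_of_nonneg (fun i _ => hρ0 _)]
  simp_rw [e1]
  have hmi : ∀ i : Fin N, Measurable fun x => ENNReal.ofReal (ρ (momentumFlip i x)) * κ x := fun i =>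
    (hρm'.comp (measurable_momentumFlip i)).mul hκ
  calc ∫⁻ x, ENNReal.ofReal ε * (∑ i : Fin N, ENNReal.ofReal (ρ (momentumFlip i x))) * κ x
      = ∫⁻ x, ENNReal.ofReal ε * ∑ i : Fin N, ENNReal.ofReal (ρ (momentumFlip i x)) * κ x := by
        refine lintegral_congr fun x => ?_
        rw [mul_assoc, Finset.sum_mul]
    _ = ENNReal.ofReal ε * ∑ i : Fin N, ∫⁻ x, ENNReal.ofReal (ρ (momentumFlip i x)) * κ x := by
        rw [lintegral_const_mul _ (Finset.measurable_sum _ fun i _ => hmi i), lintegral_finsetSum _ fun i _ => hmi i]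
    _ = ENNReal.ofReal ε * ∑ i : Fin N, ∫⁻ x, ENNReal.ofReal (ρ x) * κ (momentumFlip i x) := by
        congr 1
        refine Finset.sum_congr rfl fun i _ => ?_
        have h : ∫⁻ x, ENNReal.ofReal (ρ (momentumFlip i (momentumFlip i x))) * κ (momentumFlip i x) =
            ∫⁻ x, ENNReal.ofReal (ρ (momentumFlip i x)) * κ x :=
          lintegral_comp_momentumFlip_volume i ((hρm'.comp (measurable_momentumFlip i)).mul hκ)
        simp only [momentumFlip_momentumFlip] at h
        exact h.symm

section Pinned

variable {ω₂ lam β γ : ℝ} (hω : 0 < ω₂) (hl : 0 < lam) (hβ : 0 < β) (hγ : 0 < γ)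
  {T_L T_R : ℝ} (hN : 0 < N) (hL : 0 < T_L) (hR : 0 < T_R)

include hω hl hβ hγ hN hL hR in
/-- **The resolvent side**: for every measure `μ` on phase space, `r > 0` and measurable `A`,
`((μQ) R_r)(A) = ∫ N⁻¹ ∑ᵢ ∫_{t>0} r e^{-rt} P_t(Θᵢ x, A) dt dμ(x)` with the model-free transition kernels
`P_t = langevinKernel` of the pinned chain. [folklore] -/
theorem bind_flipKernel_bind_resolventKernel_apply (μ : Measure (PhaseSpace N)) {r : ℝ} (hr : 0 < r)
    {A : Set (PhaseSpace N)} (hA : MeasurableSet A) :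
    ((μ.bind (flipKernel N)).bind
        ((pinnedChainSemigroup hω hl.le hβ.le hγ.le hN hL.le hR.le).resolventKernel r)) A =
      ∫⁻ x, ((N : ℝ≥0∞)⁻¹ * ∑ i : Fin N, ∫⁻ t in Set.Ioi (0 : ℝ), ENNReal.ofReal (r * Real.exp (-(r * t))) *
        ((pinnedChain ω₂ lam β γ).langevinKernel N T_L T_R t.toNNReal (momentumFlip i x)) A) ∂μ := by
  set S := pinnedChainSemigroup hω hl.le hβ.le hγ.le hN hL.le hR.le with hS
  haveI := S.isMarkovKernel_resolventKernel hr
  haveI := isProbabilityMeasure_expMeasure hr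
  -- the time integrand and its measurability
  have hkm : Measurable fun p : PhaseSpace N × ℝ => (S.kernel p.2.toNNReal p.1) A := by
    have h0 := S.measurable_kernel.comp
      ((measurable_real_toNNReal.comp measurable_snd).prodMk (measurable_fst (α := PhaseSpace N) (β := ℝ)))
    have h1 : Measurable fun p : PhaseSpace N × ℝ => S.kernel p.2.toNNReal p.1 := by
      dsimp only [Function.comp_def] at h0
      exact h0
    exact (Measure.measurable_measure.1 h1) A hA
  have hFm : Measurable fun z : PhaseSpace N => ∫⁻ t, (S.kernel t.toNNReal z) A ∂(expMeasure r) :=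
    hkm.lintegral_prod_right'
  -- `R_r(z, A) = ∫ P_{t⁺}(z, A) Exp_r(dt)`
  have hR : ∀ z, (S.resolventKernel r z) A = ∫⁻ t, (S.kernel t.toNNReal z) A ∂(expMeasure r) := fun z =>
    S.resolventKernel_apply hr z hA
  rw [Measure.bind_apply hA (Kernel.aemeasurable _)]
  simp_rw [hR]
  rw [Measure.lintegral_bind (Kernel.aemeasurable (flipKernel N)) hFm.aemeasurable]
  refine lintegral_congr fun x => ?_
  rw [lintegral_flipKernel hN]
  congr 1
  refine Finset.sum_congr rfl fun i _ => ?_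
  have hkz : Measurable fun t : ℝ => (S.kernel t.toNNReal (momentumFlip i x)) A := by
    simpa only [Function.comp_def, id] using hkm.comp (measurable_const.prodMk measurable_id)
  rw [lintegral_expMeasure r hkz]
  refine setLIntegral_congr_fun measurableSet_Ioi fun t _ => ?_
  rw [hS, pinnedChainSemigroup_kernel, ← pinnedChain_langevinKernel_eq_transitionKernel N T_L T_R hω hl.le hβ.le hγ.le]

end Pinned

end Summit.AtomisticToContinuum.FouriersLaw.Theorems.NoisyFourier.FlipResolvent

/-! ### The registered stub -/

namespace Summit.AtomisticToContinuum.FouriersLaw.Cruxes.NoisyFourier.SectorDirichletGluing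

open MeasureTheory ProbabilityTheory Filter Topology Set
open Literature.MathematicalPhysics.KineticTheory.HeatConduction
open Literature.MathematicalPhysics.KineticTheory Literature.Probability.Process OscillatorChain
open Summit.AtomisticToContinuum.FouriersLaw.Theorems.SubdiffusiveBondHeat
open Summit.AtomisticToContinuum.FouriersLaw.Theorems.NessUnique
open Summit.AtomisticToContinuum.FouriersLaw.Theorems.NoisyFourier.FlipResolvent

set_option maxHeartbeats 1600000 in
/-- **Stub 1b-β — the resolvent identification of a weak flip steady state.** For the pinned anharmonic chain
(all parameters `> 0`), `N ≥ 1`, `T_L, T_R > 0`, `ε > 0`: a weak steady state `μ` of `L + εS` with a smooth density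
equals `(μ Q) R_{Nε}` (`Q = flipKernel N`, `R_r` the resolvent kernel of `pinnedChainSemigroup`). See the module
docstring for the proof (parts 1–7 of this series). [cite: BernardinOlla2011, Prop 1] -/
theorem stub_flipSteadyState_eq_bind_resolventKernel :
    ∀ (ω₂ lam β γ : ℝ) (hω : 0 < ω₂) (hl : 0 < lam) (hβ : 0 < β) (hγ : 0 < γ) (ε : ℝ), 0 < ε →
      ∀ (N : ℕ) (T_L T_R : ℝ) (hN : 0 < N) (hL : 0 < T_L) (hR : 0 < T_R)
        (μ : MeasureTheory.Measure
            (Literature.MathematicalPhysics.KineticTheory.HeatConduction.PhaseSpace N)),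
          (Literature.MathematicalPhysics.KineticTheory.HeatConduction.pinnedChain
              ω₂ lam β γ).IsFlipSteadyState N T_L T_R ε μ →
          Literature.MathematicalPhysics.KineticTheory.HeatConduction.HasSmoothDensity μ →
          μ = (μ.bind (Literature.MathematicalPhysics.KineticTheory.HeatConduction.flipKernel N)).bind
            ((Literature.MathematicalPhysics.KineticTheory.HeatConduction.pinnedChainSemigroup
                hω hl.le hβ.le hγ.le hN hL.le hR.le).resolventKernel ((N : ℝ) * ε)) := by
  intro ω₂ lam β γ hω hl hβ hγ ε hε N T_L T_R hN hL hR μ hμ hsm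
  set P := pinnedChain ω₂ lam β γ with hPdef
  set S := pinnedChainSemigroup hω hl.le hβ.le hγ.le hN hL.le hR.le with hS
  set r : ℝ := (N : ℝ) * ε with hr
  have hr0 : 0 < r := by rw [hr]; positivity
  obtain ⟨hprob, hweak, -⟩ := hμ
  haveI := hprob
  haveI := S.isMarkovKernel_resolventKernel hr0
  haveI : IsProbabilityMeasure (μ.bind (flipKernel N)) := by infer_instance
  haveI : IsProbabilityMeasure ((μ.bind (flipKernel N)).bind (S.resolventKernel r)) := by infer_instance
  have hPc : P.IsConfining := pinnedChain_isConfining hω hl.le hβ.le hγ.le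
  have hU : ContDiff ℝ ((⊤ : ℕ∞) : WithTop ℕ∞) P.U := pinnedChain_contDiff_U ω₂ lam β γ
  have hV : ContDiff ℝ ((⊤ : ℕ∞) : WithTop ℕ∞) P.V := pinnedChain_contDiff_V ω₂ lam β γ
  have hγ' : P.γ = γ := rfl
  -- the smooth density
  obtain ⟨ρ, hρs, hρ0, hμρ⟩ := hsm
  have hρ2 : ContDiff ℝ 2 ρ := hρs.of_le (by norm_cast)
  have hρc : Continuous ρ := hρs.continuous
  have hρm : Measurable fun x => ENNReal.ofReal (ρ x) := hρc.measurable.ennreal_ofReal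
  have hlin : ∫⁻ x, ENNReal.ofReal (ρ x) = μ Set.univ := by
    rw [hμρ, withDensity_apply _ MeasurableSet.univ, Measure.restrict_univ]
  have hρi : Integrable ρ := by
    refine ⟨hρc.aestronglyMeasurable, ?_⟩
    rw [hasFiniteIntegral_iff_enorm]
    have e : ∀ x, ‖ρ x‖ₑ = ENNReal.ofReal (ρ x) := fun x => Real.enorm_eq_ofReal (hρ0 x)
    simp_rw [e, hlin]
    exact measure_lt_top μ _
  -- the weak flip equation against the density, and the pointwise equation with a source
  have hweak' : ∀ φ : PhaseSpace N → ℝ, ContDiff ℝ ∞ φ → HasCompactSupport φ →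
      ∫ x, P.flipGenerator N T_L T_R ε φ x * ρ x = 0 := by
    intro φ hφ hφc
    have h := hweak φ hφ hφc
    have e : (fun x => ENNReal.ofReal (ρ x)) = fun x => ((ρ x).toNNReal : ℝ≥0∞) := rfl
    rw [hμρ, e, integral_withDensity_eq_integral_smul hρc.measurable.real_toNNReal] at h
    rw [← h]
    refine integral_congr_ae (Eventually.of_forall fun x => ?_)
    show P.flipGenerator N T_L T_R ε φ x * ρ x = (ρ x).toNNReal • P.flipGenerator N T_L T_R ε φ x
    rw [NNReal.smul_def, smul_eq_mul, Real.coe_toNNReal _ (hρ0 x), mul_comm]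
  have hpde0 := flip_revGenerator_add_eq_zero_of_weak P hU hV hN (mul_nonneg hγ.le hL.le) (mul_nonneg hγ.le hR.le)
    ε hρ2 hweak'
  set g : PhaseSpace N → ℝ := fun x => ε * ∑ i : Fin N, ρ (momentumFlip i x) with hg
  have hpde : ∀ x, sdeGenerator (fun y => -P.drift N y) (P.bathVecL N T_L) (P.bathVecR N T_R) ρ x +
      (2 * P.γ - r) * ρ x + g x = 0 := by
    intro x
    have h := hpde0 x
    have e : ε * flipNoise N ρ x = g x - r * ρ x := by
      simp only [hg, hr, flipNoise_eq, Finset.sum_sub_distrib, Finset.sum_const, Finset.card_univ,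
        Fintype.card_fin, nsmul_eq_mul]
      ring
    rw [e] at h
    linarith
  have hgc : Continuous g := continuous_const.mul
    (continuous_finsetSum _ fun i _ => hρc.comp (continuous_momentumFlip i))
  have hg0 : ∀ x, 0 ≤ g x := fun x => mul_nonneg hε.le (Finset.sum_nonneg fun i _ => hρ0 _)
  have hgi : Integrable g := by
    refine Integrable.const_mul (integrable_finsetSum _ fun i _ => ?_) ε
    exact (integrable_comp_momentumFlip_iff (measurePreserving_momentumFlip_volume i)).2 hρi
  -- polynomial volume growth of the sublevel sets
  have hvol : ∃ (C : ℝ) (d : ℕ), 0 ≤ C ∧ ∀ R : ℝ, 1 ≤ R →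
      (volume {x : PhaseSpace N | P.hamiltonian N x ≤ 4 * R}).toReal ≤ C * R ^ d := by
    obtain ⟨C, d, hC, hCE⟩ := pinnedChain_volume_sublevel_le hω hl.le hβ.le γ N
    refine ⟨C * 4 ^ d, d, by positivity, fun R hR1 => ?_⟩
    have h := hCE (4 * R) (by linarith)
    calc (volume {x : PhaseSpace N | P.hamiltonian N x ≤ 4 * R}).toReal ≤ C * (4 * R) ^ d := h
      _ = C * 4 ^ d * R ^ d := by rw [mul_pow]; ring
  -- the setwise inequality for the resolvent
  have hle : ∀ A : Set (PhaseSpace N), MeasurableSet A →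
      ((μ.bind (flipKernel N)).bind (S.resolventKernel r)) A ≤ μ A := by
    intro A hA
    have hkey := lintegral_Ioi_kernel_le_src (c := 2 * P.γ - r) hU hV hN hL.le hR.le hρ2 hρ0 hρi hgc hg0 hgi
      hpde hvol hPc hA
    -- the right side is `μ A`
    have hμA : ∫⁻ x in A, ENNReal.ofReal (ρ x) = μ A := by rw [hμρ, withDensity_apply _ hA]
    rw [hμA] at hkey
    refine le_trans (le_of_eq ?_) hkey
    -- the left side is `((μQ)R)(A)`
    rw [bind_flipKernel_bind_resolventKernel_apply hω hl hβ hγ hN hL hR μ hr0 hA]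
    -- measurability of `x ↦ P_t(Θᵢ x, A)` jointly in `(x, t)`
    have hkm : Measurable fun p : PhaseSpace N × ℝ => (P.langevinKernel N T_L T_R p.2.toNNReal p.1) A := by
      have h0 := (hPc.measurable_langevinKernel N T_L T_R).comp
        ((measurable_real_toNNReal.comp measurable_snd).prodMk (measurable_fst (α := PhaseSpace N) (β := ℝ)))
      have h1 : Measurable fun p : PhaseSpace N × ℝ => P.langevinKernel N T_L T_R p.2.toNNReal p.1 := by
        dsimp only [Function.comp_def] at h0
        exact h0
      exact (Measure.measurable_measure.1 h1) A hA
    have hkmi : ∀ i : Fin N, Measurable fun p : PhaseSpace N × ℝ =>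
        (P.langevinKernel N T_L T_R p.2.toNNReal (momentumFlip i p.1)) A := fun i =>
      hkm.comp (((measurable_momentumFlip i).comp measurable_fst).prodMk measurable_snd)
    have hexpm : Measurable fun t : ℝ => ENNReal.ofReal (r * Real.exp (-(r * t))) :=
      (continuous_const.mul (Real.continuous_exp.comp (continuous_const.mul continuous_id).neg)).measurable.ennreal_ofReal
    have hexpm' : Measurable fun t : ℝ => ENNReal.ofReal (Real.exp ((2 * P.γ - r - 2 * P.γ) * t)) :=
      (Real.continuous_exp.comp (continuous_const.mul continuous_id)).measurable.ennreal_ofReal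
    -- rewrite `μ = ρ dx` on the left and expand
    have hinner : ∀ i : Fin N, Measurable fun x => ∫⁻ t in Set.Ioi (0 : ℝ), ENNReal.ofReal (r * Real.exp (-(r * t))) *
        (P.langevinKernel N T_L T_R t.toNNReal (momentumFlip i x)) A := by
      intro i
      have h := ((hexpm.comp measurable_snd).mul (hkmi i)).lintegral_prod_right' (ν := volume.restrict (Set.Ioi (0:ℝ)))
      simpa only [Function.comp_def, Pi.mul_apply] using h
    have hsumm : Measurable fun x => (N : ℝ≥0∞)⁻¹ * ∑ i : Fin N, ∫⁻ t in Set.Ioi (0 : ℝ),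
        ENNReal.ofReal (r * Real.exp (-(r * t))) * (P.langevinKernel N T_L T_R t.toNNReal (momentumFlip i x)) A :=
      (Finset.measurable_sum _ fun i _ => hinner i).const_mul _
    rw [hμρ, lintegral_withDensity_eq_lintegral_mul₀ hρm.aemeasurable hsumm.aemeasurable]
    simp only [Pi.mul_apply]
    -- both sides as `∑ᵢ ∫_{t>0} w(t) ∫ ρ(x) P_t(Θᵢ x, A) dx dt`
    have hL : ∫⁻ x, ENNReal.ofReal (ρ x) * ((N : ℝ≥0∞)⁻¹ * ∑ i : Fin N, ∫⁻ t in Set.Ioi (0 : ℝ),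
        ENNReal.ofReal (r * Real.exp (-(r * t))) * (P.langevinKernel N T_L T_R t.toNNReal (momentumFlip i x)) A) =
        (N : ℝ≥0∞)⁻¹ * ∑ i : Fin N, ∫⁻ t in Set.Ioi (0:ℝ), ENNReal.ofReal (r * Real.exp (-(r * t))) *
          ∫⁻ x, ENNReal.ofReal (ρ x) * (P.langevinKernel N T_L T_R t.toNNReal (momentumFlip i x)) A := by
      have hmi : ∀ i : Fin N, Measurable fun x => ENNReal.ofReal (ρ x) * ∫⁻ t in Set.Ioi (0 : ℝ),
          ENNReal.ofReal (r * Real.exp (-(r * t))) * (P.langevinKernel N T_L T_R t.toNNReal (momentumFlip i x)) A :=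
        fun i => hρm.mul (hinner i)
      calc _ = ∫⁻ x, (N : ℝ≥0∞)⁻¹ * ∑ i : Fin N, ENNReal.ofReal (ρ x) * ∫⁻ t in Set.Ioi (0 : ℝ),
            ENNReal.ofReal (r * Real.exp (-(r * t))) * (P.langevinKernel N T_L T_R t.toNNReal (momentumFlip i x)) A := by
            refine lintegral_congr fun x => ?_
            rw [mul_left_comm, Finset.mul_sum]
        _ = (N : ℝ≥0∞)⁻¹ * ∑ i : Fin N, ∫⁻ x, ENNReal.ofReal (ρ x) * ∫⁻ t in Set.Ioi (0 : ℝ),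
            ENNReal.ofReal (r * Real.exp (-(r * t))) * (P.langevinKernel N T_L T_R t.toNNReal (momentumFlip i x)) A := by
            rw [lintegral_const_mul _ (Finset.measurable_sum _ fun i _ => hmi i), lintegral_finsetSum _ fun i _ => hmi i]
        _ = _ := by
            congr 1
            refine Finset.sum_congr rfl fun i _ => ?_
            -- Tonelli: `∫ ρ(x) ∫_t w P_t(Θᵢx,A) dt dx = ∫_t w ∫ ρ(x) P_t(Θᵢ x, A) dx dt`
            have hF : Measurable (Function.uncurry fun (x : PhaseSpace N) (t : ℝ) =>
                ENNReal.ofReal (ρ x) * (ENNReal.ofReal (r * Real.exp (-(r * t))) *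
                  (P.langevinKernel N T_L T_R t.toNNReal (momentumFlip i x)) A)) := by
              have h := (hρm.comp measurable_fst).mul ((hexpm.comp measurable_snd).mul (hkmi i))
              exact h
            have hti : ∀ x : PhaseSpace N, Measurable fun t : ℝ => ENNReal.ofReal (r * Real.exp (-(r * t))) *
                (P.langevinKernel N T_L T_R t.toNNReal (momentumFlip i x)) A := fun x => by
              simpa only [Function.comp_def, id, Pi.mul_def] using hexpm.mul ((hkmi i).comp (measurable_const.prodMk measurable_id))
            have hxi : ∀ t : ℝ, Measurable fun x : PhaseSpace N => ENNReal.ofReal (ρ x) *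
                (ENNReal.ofReal (r * Real.exp (-(r * t))) * (P.langevinKernel N T_L T_R t.toNNReal (momentumFlip i x)) A) :=
              fun t => by
              simpa only [Function.comp_def, id, Pi.mul_def] using
                hρm.mul (measurable_const.mul ((hkmi i).comp (measurable_id.prodMk measurable_const)))
            calc ∫⁻ x, ENNReal.ofReal (ρ x) * ∫⁻ t in Set.Ioi (0 : ℝ), ENNReal.ofReal (r * Real.exp (-(r * t))) *
                  (P.langevinKernel N T_L T_R t.toNNReal (momentumFlip i x)) A
                = ∫⁻ x, ∫⁻ t in Set.Ioi (0 : ℝ), ENNReal.ofReal (ρ x) * (ENNReal.ofReal (r * Real.exp (-(r * t))) *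
                  (P.langevinKernel N T_L T_R t.toNNReal (momentumFlip i x)) A) := by
                    refine lintegral_congr fun x => ?_
                    rw [lintegral_const_mul _ (hti x)]
              _ = ∫⁻ t in Set.Ioi (0 : ℝ), ∫⁻ x, ENNReal.ofReal (ρ x) * (ENNReal.ofReal (r * Real.exp (-(r * t))) *
                  (P.langevinKernel N T_L T_R t.toNNReal (momentumFlip i x)) A) :=
                    lintegral_lintegral_swap (μ := volume) (ν := volume.restrict (Set.Ioi (0:ℝ))) hF.aemeasurable
              _ = _ := by
                    refine lintegral_congr fun t => ?_
                    have hxi' : Measurable fun x : PhaseSpace N => ENNReal.ofReal (ρ x) *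
                        (P.langevinKernel N T_L T_R t.toNNReal (momentumFlip i x)) A := by
                      simpa only [Function.comp_def, id, Pi.mul_def] using hρm.mul ((hkmi i).comp (measurable_id.prodMk measurable_const))
                    rw [← lintegral_const_mul _ hxi']
                    refine lintegral_congr fun x => ?_
                    ring
    rw [hL]
    -- the right side of `hkey`
    have hRw : ∀ t : ℝ, ENNReal.ofReal (Real.exp ((2 * P.γ - r - 2 * P.γ) * t)) = ENNReal.ofReal (Real.exp (-(r * t))) := by
      intro t; congr 1; congr 1; ring
    have hRside : ∫⁻ s in Set.Ioi (0 : ℝ), ENNReal.ofReal (Real.exp ((2 * P.γ - r - 2 * P.γ) * s)) *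
        ∫⁻ x, ENNReal.ofReal (g x) * (P.langevinKernel N T_L T_R s.toNNReal x) A =
        ∫⁻ s in Set.Ioi (0 : ℝ), ENNReal.ofReal (Real.exp (-(r * s))) * (ENNReal.ofReal ε *
          ∑ i : Fin N, ∫⁻ x, ENNReal.ofReal (ρ x) * (P.langevinKernel N T_L T_R s.toNNReal (momentumFlip i x)) A) := by
      refine lintegral_congr fun s => ?_
      have hks : Measurable fun x : PhaseSpace N => (P.langevinKernel N T_L T_R s.toNNReal x) A := by
        simpa only [Function.comp_def, id] using hkm.comp (measurable_id.prodMk measurable_const)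
      rw [hRw s, lintegral_flipSource_mul_eq ε hε.le hρc.measurable hρ0 hks]
    rw [hRside]
    -- compare the weights: `N⁻¹ · r e^{-rt} = ε e^{-rt}`
    have hw : ∀ t : ℝ, (N : ℝ≥0∞)⁻¹ * ENNReal.ofReal (r * Real.exp (-(r * t))) =
        ENNReal.ofReal (Real.exp (-(r * t))) * ENNReal.ofReal ε := by
      intro t
      rw [hr, mul_assoc, ENNReal.ofReal_mul (by positivity : (0:ℝ) ≤ (N : ℝ)), ENNReal.ofReal_natCast, ← mul_assoc,
        ENNReal.inv_mul_cancel (by exact_mod_cast hN.ne') (ENNReal.natCast_ne_top N), one_mul,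
        ENNReal.ofReal_mul hε.le, mul_comm]
    have hmeasI : ∀ i : Fin N, Measurable fun t : ℝ => ∫⁻ x, ENNReal.ofReal (ρ x) *
        (P.langevinKernel N T_L T_R t.toNNReal (momentumFlip i x)) A := by
      intro i
      have h := ((hρm.comp measurable_fst).mul (hkmi i)).lintegral_prod_left' (μ := (volume : Measure (PhaseSpace N)))
      simpa only [Function.comp_def, Pi.mul_apply] using h
    have hexpm'' : Measurable fun t : ℝ => ENNReal.ofReal (Real.exp (-(r * t))) :=
      (Real.continuous_exp.comp (continuous_const.mul continuous_id).neg).measurable.ennreal_ofReal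
    have hI : ∀ i : Fin N, (N : ℝ≥0∞)⁻¹ * (∫⁻ t in Set.Ioi (0 : ℝ), ENNReal.ofReal (r * Real.exp (-(r * t))) *
        ∫⁻ x, ENNReal.ofReal (ρ x) * (P.langevinKernel N T_L T_R t.toNNReal (momentumFlip i x)) A) =
        ∫⁻ t in Set.Ioi (0 : ℝ), ENNReal.ofReal (Real.exp (-(r * t))) * ENNReal.ofReal ε *
          ∫⁻ x, ENNReal.ofReal (ρ x) * (P.langevinKernel N T_L T_R t.toNNReal (momentumFlip i x)) A := by
      intro i
      rw [← lintegral_const_mul _ (hexpm.fun_mul (hmeasI i))]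
      refine lintegral_congr fun t => ?_
      rw [← mul_assoc, hw t]
    rw [Finset.mul_sum, Finset.sum_congr rfl fun i _ => hI i,
      ← lintegral_finsetSum _ fun i _ => (hexpm''.fun_mul measurable_const).fun_mul (hmeasI i)]
    refine lintegral_congr fun t => ?_
    rw [Finset.mul_sum, Finset.mul_sum]
    refine Finset.sum_congr rfl fun i _ => ?_
    rw [mul_assoc]
  -- two probability measures comparable setwise are equal
  exact (measure_eq_of_le_of_measure_univ_eq hle (by rw [measure_univ, measure_univ])).symm

end Summit.AtomisticToContinuum.FouriersLaw.Cruxes.NoisyFourier.SectorDirichletGluing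

end
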